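import Literature.Computability.FineGrained.APSPPowerDriver
import HarnessLib

/-!
# Distance product `≤₃` APSP (VW–W 2018, proof of Thm. 5.1): the word-RAM program

Vassilevska Williams–Williams, J. ACM 65 (2018), proof of Thm. 5.1 (p. 27:22): the `(min,+)`
product of two `n × n` matrices `A, B` is read off one APSP computation on the tripartite graph with
parts `I, J, K`, arcs `i → j` of weight `A[i, j]` and `j → k` of weight `B[j, k]` (for directed APSP no
weight shift is needed; the graph is `productLayeredGraph A B` of
`Literature.Computability.Cryptography.ProductLayeredGraph`, on `3 n` vertices, copy `ℓ` of vertex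
`a` being vertex `ℓ n + a`). The prelude renders `≤₃` as `FGReducible` (VVW ICM 2018, Def. 2.1):
the existence of a concrete deterministic word-RAM oracle program. This file writes that program
down as structured code (`SProg` of `Literature.Computability.Cryptography.WordRAMStructured`) and
proves the semantics of its phases; the assembly into
`FGReducible (MinPlusProduct c) (n ↦ n³) (APSP c) (n ↦ n³)` is
`Literature.Computability.FineGrained.MinPlusProductToAPSP`.

## The program `prog`

* `relocate` (the library bootstrap): the input `⌜A⌝ ++ ⌜B⌝` (`2 n² + 2` words) is moved to the
  data area, `n` landing at `pA n = 2 n² + 103`, the codes of `A` at `pA n + 1 + t` and those of `B`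
  at `pB n + 1 + t` (`pB n = pA n + n² + 1`), `t = i n + j` row-major;
* `setupOps`: the layout registers (`Regs`) and the header `3 n` of the query block at
  `pQ n = 4 n² + 105`;
* two runs of the **row loop** `rowLoop` (a counted loop around the library's `copyUp`, copying `R`
  rows of `n` words with source stride `σ` and destination stride `τ`; `rowLoop_spec`): the rows of
  `A` go to the cells of the arcs `i₀ → j₁` (offsets `i N + n + j` of the row-major `N × N` query
  matrix, `N = 3 n`), the rows of `B` to the cells of the arcs `j₁ → k₂` (offsets
  `(n + j) N + 2 n + k`); every other cell of the query block keeps its initial `0`, the code of `⊤`;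
* the oracle `query` on the block `[pQ n, pQ n + 9 n²]`, answer (its length, then
  `⌜shortestDist G⌝`) at `pR n = 13 n² + 106`;
* a third run of `rowLoop` copying the `n` answer rows of the distances `i₀ ↝ k₂` (offsets
  `i N + 2 n + k` of the answer matrix) over the codes of `A`;
* `relayOps` re-purposes the registers to the layout of the square-and-multiply driver of
  `Literature.Computability.FineGrained.APSPPowerDriver` (`APSPPower.Lay`; the result block
  `pA n = APSPPower.dQA n` is its accumulator block), whose verified output phases — staging above a
  zero sentinel (`APSPPower.stagePre`, `stageBody`) and the downward copy into the output cells with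
  only the cells `0, 1` as registers (`finalPre`, `finalBody`, `finalPost`) — finish the program.

## Proof technique

Symbolic execution of straight-line blocks one operation at a time (`execOps_cons_fwd` with the
`merge` register/data normaliser of `Literature.Computability.Cryptography.WordRAMStructuredBlocks`),
the invariant loop rule `ExecLE.whilenz_invariant`, and the library's `copyUp_spec`.

## References

* V. Vassilevska Williams, R. R. Williams, *Subcubic equivalences between path, matrix, and triangle
  problems*, J. ACM 65 (2018), Art. 27, proof of Thm. 5.1 (p. 27:22). doi:10.1145/3186893
* V. Vassilevska Williams, *On some fine-grained questions in algorithms and complexity*, Proc. ICM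
  2018, §2, Def. 2.1 (fine-grained reductions on the word RAM).
* T. Nipkow, G. Klein, *Concrete Semantics with Isabelle/HOL*, Springer 2014, §7, §12 (big-step
  semantics, loop invariants).
-/

namespace Literature.Computability.FineGrained.MinPlusToAPSP

open Cryptography Cryptography.WordRAM Cryptography.WordRAM.SProg Matrix

/-! ## Memory layout -/

/-- Base of the relocated input (`relocate` puts `n` at `pD n` and the input words from `pD n + 1`
on; the input has `2 n² + 2` words). [folklore] -/
def pD (n : ℕ) : ℕ := 2 * (n * n) + 102
/-- Header cell of the block of `A` (`n` at `pA n`, the code of `A i j` at `pA n + 1 + (i n + j)`);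
this is `APSPPower.dQA n`, the accumulator block of the driver whose output phases we reuse. [folklore] -/
def pA (n : ℕ) : ℕ := 2 * (n * n) + 103
/-- Header cell of the block of `B`. [folklore] -/
def pB (n : ℕ) : ℕ := 3 * (n * n) + 104
/-- Header cell of the query block (`3 n`, then the `9 n²` codes of the product layered graph). [folklore] -/
def pQ (n : ℕ) : ℕ := 4 * (n * n) + 105
/-- The answer cell (the oracle writes the answer's length here and its words after it). [folklore] -/
def pR (n : ℕ) : ℕ := 13 * (n * n) + 106
/-- The first cell above everything the program touches before the output phases. [folklore] -/
def pTop (n : ℕ) : ℕ := 22 * (n * n) + 108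

/-- `pA n` is the accumulator block base `APSPPower.dQA n` of the driver. [folklore] -/
theorem pA_eq_dQA (n : ℕ) : pA n = APSPPower.dQA n := by
  rw [APSPPower.dQA_eq]; rfl

/-! ## The program -/

/-- Preparing one run of the copy loop inside the row loop: count `r12 := n`, source `r13 := r31`,
destination `r14 := r32`. [folklore] -/
def rowPre : List OpSpec :=
  [(.add, .dir 12, .dir 2, .imm 0), (.add, .dir 13, .dir 31, .imm 0), (.add, .dir 14, .dir 32, .imm 0)]

/-- Closing one iteration of the row loop: advance the row pointers by the strides `r33`, `r34` and
count down `r30`. [folklore] -/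
def rowPost : List OpSpec :=
  [(.add, .dir 31, .dir 31, .dir 33), (.add, .dir 32, .dir 32, .dir 34), (.sub, .dir 30, .dir 30, .imm 1)]

/-- **The row loop**: while `r30 ≠ 0`, copy the `n = r2` words at `r31` to `r32` (by `copyUp`), then
`r31 += r33`, `r32 += r34`, `r30 -= 1` — i.e. copy `r30` rows of `n` words from a matrix with row
stride `r33` into a matrix with row stride `r34`. [folklore] -/
def rowLoop : SProg :=
  whilenz (.dir 30) (seqs [block rowPre, copyUp, block rowPost])

/-- The setup block (after `relocate`, cell `1` holds `pD n` and cell `pD n` holds `n`): the layout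
registers `r2 = n`, `r3 = N = 3 n`, `r4 = n² + 1`, `r5 = pA n`, `r6 = pQ n`, `r7 = pQ n + 1 + n`,
`r8 = n N + n`, `r9 = 9 n² + 1` (the query length), `r10 = pR n`, `r11 = pR n + 2 + 2 n`, the query
header `mem[pQ n] := N`, and the parameters of the first row loop (`r30 = n` rows from
`r31 = pA n + 1`, stride `r33 = n`, to `r32 = pQ n + 1 + n`, stride `r34 = N`). [folklore] -/
def setupOps : List OpSpec :=
  [(.add, .dir 2, .ind 1, .imm 0), (.mul, .dir 3, .dir 2, .imm 3), (.mul, .dir 20, .dir 2, .dir 2),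
    (.add, .dir 4, .dir 20, .imm 1), (.add, .dir 5, .dir 1, .imm 1),
    (.mul, .dir 6, .dir 20, .imm 2), (.add, .dir 6, .dir 6, .dir 5), (.add, .dir 6, .dir 6, .imm 2),
    (.add, .dir 7, .dir 6, .dir 2), (.add, .dir 7, .dir 7, .imm 1),
    (.mul, .dir 8, .dir 20, .imm 3), (.add, .dir 8, .dir 8, .dir 2),
    (.mul, .dir 9, .dir 20, .imm 9), (.add, .dir 9, .dir 9, .imm 1),
    (.add, .dir 10, .dir 6, .dir 9),
    (.mul, .dir 11, .dir 2, .imm 2), (.add, .dir 11, .dir 11, .dir 10), (.add, .dir 11, .dir 11, .imm 2),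
    (.add, .ind 6, .dir 3, .imm 0),
    (.add, .dir 30, .dir 2, .imm 0), (.add, .dir 31, .dir 5, .imm 1), (.add, .dir 32, .dir 7, .imm 0),
    (.add, .dir 33, .dir 2, .imm 0), (.add, .dir 34, .dir 3, .imm 0)]

/-- Parameters of the second row loop: `n` rows of `B` from `pB n + 1 = pA n + (n² + 1) + 1`,
stride `n`, to the cells of the arcs `j₁ → k₂` from `pQ n + 1 + n N + 2 n = r7 + r8`, stride `N`. [folklore] -/
def preQB : List OpSpec :=
  [(.add, .dir 30, .dir 2, .imm 0), (.add, .dir 31, .dir 5, .dir 4), (.add, .dir 31, .dir 31, .imm 1),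
    (.add, .dir 32, .dir 7, .dir 8), (.add, .dir 33, .dir 2, .imm 0), (.add, .dir 34, .dir 3, .imm 0)]

/-- Parameters of the third row loop: the `n` answer rows of the distances `i₀ ↝ k₂` from
`pR n + 2 + 2 n = r11`, stride `N`, over the codes of `A` from `pA n + 1`, stride `n`. [folklore] -/
def preRD : List OpSpec :=
  [(.add, .dir 30, .dir 2, .imm 0), (.add, .dir 31, .dir 11, .imm 0), (.add, .dir 32, .dir 5, .imm 1),
    (.add, .dir 33, .dir 3, .imm 0), (.add, .dir 34, .dir 2, .imm 0)]

/-- Re-purposing the registers to the layout `APSPPower.Lay` of the driver's output phases: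
`r3 := n²`, `r4 := dD n = n² + 101`, `r6 := dQP n = r5 + n² + 1`, `r7 := dQP2 n = r6 + n² + 1`,
`r8 := dOUT n = r7 + n² + 1` (`r2 = n` and `r5 = pA n = dQA n` already agree). [folklore] -/
def relayOps : List OpSpec :=
  [(.mul, .dir 3, .dir 2, .dir 2), (.add, .dir 4, .dir 3, .imm 101),
    (.add, .dir 6, .dir 5, .dir 3), (.add, .dir 6, .dir 6, .imm 1),
    (.add, .dir 7, .dir 6, .dir 3), (.add, .dir 7, .dir 7, .imm 1),
    (.add, .dir 8, .dir 7, .dir 3), (.add, .dir 8, .dir 8, .imm 1)]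

/-- **The reduction program** distance product `≤₃` APSP (this library's word-RAM rendering of the
gadget in the proof of VW–W 2018, Thm. 5.1, p. 27:22): relocate the input, set up the layout, write
the arcs of `A` and of `B` into the query block, query the APSP oracle once, copy the `I → K`
distances over the block of `A`, and emit that block through the driver's output phases.
[cite: VassilevskaWilliamsWilliams2018, proof of Thm. 5.1 (p. 27:22)] -/
def prog : SProg :=
  seqs [relocate, block setupOps, rowLoop, block preQB, rowLoop,
    SProg.query (.dir 6) (.dir 9) (.dir 10), block preRD, rowLoop, block relayOps,
    seq (block APSPPower.stagePre) (whilenz (.dir 12) (block APSPPower.stageBody)),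
    block APSPPower.finalPre, whilenz (.ind 1) (block APSPPower.finalBody), block APSPPower.finalPost]

/-- The compiled program is deterministic. [folklore] -/
theorem prog_isDeterministic : prog.toProgram.IsDeterministic :=
  toProgram_isDeterministic _

/-! ## The row loop -/

/-- The invariant of the row loop after `i` rows: the untouched registers, the counters
`r30 = R - i`, `r31 = s₀ + i σ`, `r32 = d₀ + i τ`, the `i` copied rows, and the rest of the data
unchanged. [folklore] -/
def RowInv (qs : List (List ℕ)) (S₀ H₀ : ℕ → ℕ) (n R s₀ d₀ σ τ i : ℕ) (st : Store) : Prop :=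
  ∃ S H : ℕ → ℕ, st = ⟨merge S H, qs⟩ ∧
    (∀ r, r ≠ 12 → r ≠ 13 → r ≠ 14 → r ≠ 30 → r ≠ 31 → r ≠ 32 → S r = S₀ r) ∧
    S 30 = R - i ∧ S 31 = s₀ + i * σ ∧ S 32 = d₀ + i * τ ∧
    (∀ i', i' < i → ∀ j, j < n → H (d₀ + i' * τ + j) = H₀ (s₀ + i' * σ + j)) ∧
    (∀ a, (∀ i', i' < i → ¬ (d₀ + i' * τ ≤ a ∧ a < d₀ + i' * τ + n)) → H a = H₀ a)

section rowLoop

variable {w : ℕ} {O : List ℕ → List ℕ} {S₀ H₀ : ℕ → ℕ} {n R s₀ d₀ σ τ : ℕ}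

-- The symbolic execution below uses one uniform `simp only` read-normaliser per instruction;
-- not every lemma of the set fires at every instruction.
set_option linter.unusedSimpArgs false in
/-- **One iteration of the row loop** (`i < R`): from `RowInv … i` the test register is nonzero and
the body reaches `RowInv … (i + 1)` within `6 n + 7` steps. [folklore] -/
theorem rowBody_spec (h2 : S₀ 2 = n) (h33 : S₀ 33 = σ) (h34 : S₀ 34 = τ)
    (hs : 100 ≤ s₀) (hd : 100 ≤ d₀) (hτ : n ≤ τ)
    (hdisj : s₀ + R * σ + n ≤ d₀ ∨ d₀ + R * τ + n ≤ s₀)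
    (hval : ∀ i, i < R → ∀ j, j < n → H₀ (s₀ + i * σ + j) < 2 ^ w)
    (hsw : s₀ + R * σ + n < 2 ^ w) (hdw : d₀ + R * τ + n < 2 ^ w) (hRw : R < 2 ^ w)
    (qs : List (List ℕ)) {i : ℕ} (hi : i < R) (st : Store)
    (hst : RowInv qs S₀ H₀ n R s₀ d₀ σ τ i st) :
    (Operand.dir 30).read st.mem ≠ 0 ∧
      ∃ st', ExecLE w O (seqs [block rowPre, copyUp, block rowPost]) st st' (6 * n + 7) ∧
        RowInv qs S₀ H₀ n R s₀ d₀ σ τ (i + 1) st' := by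
  obtain ⟨S, H, rfl, hS, h30, h31, h32, hrows, hoth⟩ := hst
  refine ⟨by rw [Operand.read_dir_merge (by decide), h30]; omega, ?_⟩
  -- arithmetic of the strides
  have hiσ : i * σ + σ ≤ R * σ := by
    have := Nat.mul_le_mul_right σ (Nat.succ_le_of_lt hi); rwa [Nat.succ_mul] at this
  have hiτ : i * τ + τ ≤ R * τ := by
    have := Nat.mul_le_mul_right τ (Nat.succ_le_of_lt hi); rwa [Nat.succ_mul] at this
  have h2' : S 2 = n := (hS 2 (by omega) (by omega) (by omega) (by omega) (by omega) (by omega)).trans h2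
  have h33' : S 33 = σ := (hS 33 (by omega) (by omega) (by omega) (by omega) (by omega) (by omega)).trans h33
  have h34' : S 34 = τ := (hS 34 (by omega) (by omega) (by omega) (by omega) (by omega) (by omega)).trans h34
  -- the source row is untouched so far
  have hsrc : ∀ j, j < n → H (s₀ + i * σ + j) = H₀ (s₀ + i * σ + j) := by
    intro j hj
    refine hoth _ fun i' hi' hin => ?_
    have hi'τ : i' * τ + τ ≤ R * τ := by
      have := Nat.mul_le_mul_right τ (Nat.succ_le_of_lt (hi'.trans hi)); rwa [Nat.succ_mul] at this
    rcases hdisj with hdj | hdj <;> omega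
  -- block 1: the copy registers
  obtain ⟨st₁, hex₁, S₁, rfl, h12, h13, h14, hS₁⟩ : ∃ st₁, Exec w O (block rowPre) ⟨merge S H, qs⟩ st₁ 3 ∧
      ∃ S₁, st₁ = ⟨merge S₁ H, qs⟩ ∧ S₁ 12 = n ∧ S₁ 13 = s₀ + i * σ ∧ S₁ 14 = d₀ + i * τ ∧
        ∀ r, r ≠ 12 → r ≠ 13 → r ≠ 14 → S₁ r = S r := by
    refine Exec.block_of_fwd _ _ fun Rg hR => ?_
    unfold rowPre at hR
    have htmp := execOps_cons_fwd hR; clear hR; obtain ⟨v1, hv1, hR⟩ := htmp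
    simp -failIfUnchanged (disch := omega) only [Operand.write, Operand.read, merge_apply_of_lt,
      merge_apply_of_le, Function.update_self, Function.update_of_ne, update_merge_of_lt,
      update_merge_of_le, Nat.add_zero, BinOp.eval_mod, BinOp.eval_eq, BinOp.eval_band,
      BinOp.eval_shr, BinOp.eval_div, BinOp.eval_lt, BinOp.eval_add_of_lt, BinOp.eval_sub_of_le,
      BinOp.eval_mul_of_lt, h2', h30, h31, h32] at hv1 hR; subst hv1
    have htmp := execOps_cons_fwd hR; clear hR; obtain ⟨v2, hv2, hR⟩ := htmp
    simp -failIfUnchanged (disch := omega) only [Operand.write, Operand.read, merge_apply_of_lt,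
      merge_apply_of_le, Function.update_self, Function.update_of_ne, update_merge_of_lt,
      update_merge_of_le, Nat.add_zero, BinOp.eval_mod, BinOp.eval_eq, BinOp.eval_band,
      BinOp.eval_shr, BinOp.eval_div, BinOp.eval_lt, BinOp.eval_add_of_lt, BinOp.eval_sub_of_le,
      BinOp.eval_mul_of_lt, h2', h30, h31, h32] at hv2 hR; subst hv2
    have htmp := execOps_cons_fwd hR; clear hR; obtain ⟨v3, hv3, hR⟩ := htmp
    simp -failIfUnchanged (disch := omega) only [Operand.write, Operand.read, merge_apply_of_lt,
      merge_apply_of_le, Function.update_self, Function.update_of_ne, update_merge_of_lt,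
      update_merge_of_le, Nat.add_zero, BinOp.eval_mod, BinOp.eval_eq, BinOp.eval_band,
      BinOp.eval_shr, BinOp.eval_div, BinOp.eval_lt, BinOp.eval_add_of_lt, BinOp.eval_sub_of_le,
      BinOp.eval_mul_of_lt, h2', h30, h31, h32] at hv3 hR; subst hv3
    simp only [execOps_nil] at hR; subst hR
    exact ⟨_, rfl, by simp, by simp, by simp, fun r h12' h13' h14' => by
      rw [Function.update_of_ne h14', Function.update_of_ne h13', Function.update_of_ne h12']⟩
  -- the copy
  have hdisj' : s₀ + i * σ + n ≤ d₀ + i * τ ∨ d₀ + i * τ ≤ s₀ + i * σ := by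
    rcases hdisj with hdj | hdj
    · left; omega
    · right; omega
  have hval' : ∀ j, j < n → H (s₀ + i * σ + j) < 2 ^ w := fun j hj => by
    rw [hsrc j hj]; exact hval i hi j hj
  obtain ⟨S₂, H₂, hex₂, hS₂, -, hdst, hout⟩ := copyUp_spec (w := w) (O := O) h12 h13 h14
    (by omega) (by omega) hdisj' hval' (by omega) (by omega) qs
  -- block 2: advance
  have h31₂ : S₂ 31 = s₀ + i * σ := by
    rw [hS₂ 31 (by omega) (by omega) (by omega), hS₁ 31 (by omega) (by omega) (by omega), h31]
  have h32₂ : S₂ 32 = d₀ + i * τ := by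
    rw [hS₂ 32 (by omega) (by omega) (by omega), hS₁ 32 (by omega) (by omega) (by omega), h32]
  have h30₂ : S₂ 30 = R - i := by
    rw [hS₂ 30 (by omega) (by omega) (by omega), hS₁ 30 (by omega) (by omega) (by omega), h30]
  have h33₂ : S₂ 33 = σ := by
    rw [hS₂ 33 (by omega) (by omega) (by omega), hS₁ 33 (by omega) (by omega) (by omega), h33']
  have h34₂ : S₂ 34 = τ := by
    rw [hS₂ 34 (by omega) (by omega) (by omega), hS₁ 34 (by omega) (by omega) (by omega), h34']
  obtain ⟨st₃, hex₃, S₃, rfl, h30₃, h31₃, h32₃, hS₃⟩ : ∃ st₃, Exec w O (block rowPost)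
      ⟨merge S₂ H₂, qs⟩ st₃ 3 ∧
      ∃ S₃, st₃ = ⟨merge S₃ H₂, qs⟩ ∧ S₃ 30 = R - (i + 1) ∧ S₃ 31 = s₀ + (i + 1) * σ ∧
        S₃ 32 = d₀ + (i + 1) * τ ∧ ∀ r, r ≠ 30 → r ≠ 31 → r ≠ 32 → S₃ r = S₂ r := by
    refine Exec.block_of_fwd _ _ fun Rg hR => ?_
    unfold rowPost at hR
    have htmp := execOps_cons_fwd hR; clear hR; obtain ⟨v1, hv1, hR⟩ := htmp
    simp -failIfUnchanged (disch := omega) only [Operand.write, Operand.read, merge_apply_of_lt,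
      merge_apply_of_le, Function.update_self, Function.update_of_ne, update_merge_of_lt,
      update_merge_of_le, Nat.add_zero, BinOp.eval_mod, BinOp.eval_eq, BinOp.eval_band,
      BinOp.eval_shr, BinOp.eval_div, BinOp.eval_lt, BinOp.eval_add_of_lt, BinOp.eval_sub_of_le,
      BinOp.eval_mul_of_lt, h30₂, h31₂, h32₂, h33₂, h34₂] at hv1 hR; subst hv1
    have htmp := execOps_cons_fwd hR; clear hR; obtain ⟨v2, hv2, hR⟩ := htmp
    simp -failIfUnchanged (disch := omega) only [Operand.write, Operand.read, merge_apply_of_lt,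
      merge_apply_of_le, Function.update_self, Function.update_of_ne, update_merge_of_lt,
      update_merge_of_le, Nat.add_zero, BinOp.eval_mod, BinOp.eval_eq, BinOp.eval_band,
      BinOp.eval_shr, BinOp.eval_div, BinOp.eval_lt, BinOp.eval_add_of_lt, BinOp.eval_sub_of_le,
      BinOp.eval_mul_of_lt, h30₂, h31₂, h32₂, h33₂, h34₂] at hv2 hR; subst hv2
    have htmp := execOps_cons_fwd hR; clear hR; obtain ⟨v3, hv3, hR⟩ := htmp
    simp -failIfUnchanged (disch := omega) only [Operand.write, Operand.read, merge_apply_of_lt,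
      merge_apply_of_le, Function.update_self, Function.update_of_ne, update_merge_of_lt,
      update_merge_of_le, Nat.add_zero, BinOp.eval_mod, BinOp.eval_eq, BinOp.eval_band,
      BinOp.eval_shr, BinOp.eval_div, BinOp.eval_lt, BinOp.eval_add_of_lt, BinOp.eval_sub_of_le,
      BinOp.eval_mul_of_lt, h30₂, h31₂, h32₂, h33₂, h34₂] at hv3 hR; subst hv3
    simp only [execOps_nil] at hR; subst hR
    refine ⟨_, rfl, ?_, ?_, ?_, fun r h30' h31' h32' => ?_⟩
    · rw [Function.update_self]; omega
    · rw [Function.update_of_ne (by norm_num), Function.update_of_ne (by norm_num),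
        Function.update_self]; ring
    · rw [Function.update_of_ne (by norm_num), Function.update_self]; ring
    · rw [Function.update_of_ne h30', Function.update_of_ne h32', Function.update_of_ne h31']
  -- assemble
  refine ⟨_, (hex₁.execLE.seqs_cons (hex₂.execLE.seqs_cons (ExecLE.seqs_one hex₃.execLE))).mono
    (by omega), S₃, H₂, rfl, ?_, h30₃, h31₃, h32₃, ?_, ?_⟩
  · intro r hr12 hr13 hr14 hr30 hr31 hr32
    rw [hS₃ r hr30 hr31 hr32, hS₂ r hr12 hr13 hr14, hS₁ r hr12 hr13 hr14,
      hS r hr12 hr13 hr14 hr30 hr31 hr32]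
  · intro i' hi' j hj
    rcases Nat.lt_succ_iff_lt_or_eq.1 hi' with hi' | rfl
    · have hi'τ : i' * τ + τ ≤ i * τ := by
        have := Nat.mul_le_mul_right τ (Nat.succ_le_of_lt hi'); rwa [Nat.succ_mul] at this
      rw [hout _ (Or.inl (by omega)), hrows i' hi' j hj]
    · rw [hdst j hj, hsrc j hj]
  · intro a ha
    have hai : ¬ (d₀ + i * τ ≤ a ∧ a < d₀ + i * τ + n) := ha i (Nat.lt_succ_self i)
    rw [hout a (by omega), hoth a fun i' hi' => ha i' (Nat.lt_succ_of_lt hi')]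

/-- **Semantics of the row loop.** With `n` in register `2`, `R` rows to go in `30`, the source row
pointer `s₀` in `31`, the destination row pointer `d₀` in `32` and the strides `σ, τ` in `33, 34`
(`n ≤ τ`, data addresses, source and destination regions disjoint, no wrap-around), `rowLoop` copies
the `R` rows `[s₀ + i σ, s₀ + i σ + n)` to `[d₀ + i τ, d₀ + i τ + n)` within `R (6 n + 9) + 1` steps;
the registers other than `12–14, 30–32` are kept and the data outside the destination rows is kept.
[folklore] -/
theorem rowLoop_spec (h2 : S₀ 2 = n) (h30 : S₀ 30 = R) (h31 : S₀ 31 = s₀) (h32 : S₀ 32 = d₀)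
    (h33 : S₀ 33 = σ) (h34 : S₀ 34 = τ) (hs : 100 ≤ s₀) (hd : 100 ≤ d₀) (hτ : n ≤ τ)
    (hdisj : s₀ + R * σ + n ≤ d₀ ∨ d₀ + R * τ + n ≤ s₀)
    (hval : ∀ i, i < R → ∀ j, j < n → H₀ (s₀ + i * σ + j) < 2 ^ w)
    (hsw : s₀ + R * σ + n < 2 ^ w) (hdw : d₀ + R * τ + n < 2 ^ w) (hRw : R < 2 ^ w)
    (qs : List (List ℕ)) :
    ∃ S H : ℕ → ℕ, ExecLE w O rowLoop ⟨merge S₀ H₀, qs⟩ ⟨merge S H, qs⟩ (R * (6 * n + 9) + 1) ∧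
      (∀ r, r ≠ 12 → r ≠ 13 → r ≠ 14 → r ≠ 30 → r ≠ 31 → r ≠ 32 → S r = S₀ r) ∧
      (∀ i, i < R → ∀ j, j < n → H (d₀ + i * τ + j) = H₀ (s₀ + i * σ + j)) ∧
      (∀ a, (∀ i, i < R → ¬ (d₀ + i * τ ≤ a ∧ a < d₀ + i * τ + n)) → H a = H₀ a) := by
  have h0 : RowInv qs S₀ H₀ n R s₀ d₀ σ τ 0 ⟨merge S₀ H₀, qs⟩ :=
    ⟨S₀, H₀, rfl, fun _ _ _ _ _ _ _ => rfl, by simpa using h30, by simpa using h31,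
      by simpa using h32, fun _ hi' => absurd hi' (Nat.not_lt_zero _), fun _ _ => rfl⟩
  have hexit : ∀ st, RowInv qs S₀ H₀ n R s₀ d₀ σ τ R st → (Operand.dir 30).read st.mem = 0 := by
    rintro st ⟨S, H, rfl, -, h30', -⟩
    rw [Operand.read_dir_merge (by decide), h30']
    simp
  obtain ⟨st', hex, S, H, rfl, hS, -, -, -, hrows, hoth⟩ :=
    ExecLE.whilenz_invariant (w := w) (O := O) (x := .dir 30)
      (s := seqs [block rowPre, copyUp, block rowPost]) R (6 * n + 7)
      (RowInv qs S₀ H₀ n R s₀ d₀ σ τ)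
      (fun i hi st hst => rowBody_spec h2 h33 h34 hs hd hτ hdisj hval hsw hdw hRw qs hi st hst)
      hexit h0
  exact ⟨S, H, hex.mono (Nat.le_of_eq (by ring)), hS, hrows, hoth⟩

end rowLoop

/-! ## Registers, input, relocation -/

/-- **The layout registers** after the setup: `r2 = n`, `r3 = N = 3 n`, `r4 = n² + 1`,
`r5 = pA n`, `r6 = pQ n`, `r7 = pQ n + 1 + n` (the cell of the arc `0₀ → 0₁`), `r8 = n N + n` (the
offset from the arc `i₀ → j₁` to the arc `i₁ → j₂`), `r9 = 9 n² + 1` (the query length), `r10 = pR n`,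
`r11 = pR n + 2 + 2 n` (the answer cell of the distance `0₀ ↝ 0₂`). [folklore] -/
structure Regs (n : ℕ) (S : ℕ → ℕ) : Prop where
  r2 : S 2 = n
  r3 : S 3 = 3 * n
  r4 : S 4 = n * n + 1
  r5 : S 5 = pA n
  r6 : S 6 = pQ n
  r7 : S 7 = pQ n + 1 + n
  r8 : S 8 = 3 * (n * n) + n
  r9 : S 9 = 9 * (n * n) + 1
  r10 : S 10 = pR n
  r11 : S 11 = pR n + 2 + 2 * n

/-- The layout registers survive any change of the registers `≥ 12`. [folklore] -/
theorem Regs.of_agree {n : ℕ} {S S' : ℕ → ℕ} (h : Regs n S) (hag : ∀ r, r < 12 → S' r = S r) :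
    Regs n S' := by
  obtain ⟨h2, h3, h4, h5, h6, h7, h8, h9, h10, h11⟩ := h
  exact ⟨(hag 2 (by norm_num)).trans h2, (hag 3 (by norm_num)).trans h3,
    (hag 4 (by norm_num)).trans h4, (hag 5 (by norm_num)).trans h5,
    (hag 6 (by norm_num)).trans h6, (hag 7 (by norm_num)).trans h7,
    (hag 8 (by norm_num)).trans h8, (hag 9 (by norm_num)).trans h9,
    (hag 10 (by norm_num)).trans h10, (hag 11 (by norm_num)).trans h11⟩

/-- After a row loop the layout registers are intact. [folklore] -/
theorem Regs.of_rowLoop {n : ℕ} {S S' : ℕ → ℕ} (h : Regs n S)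
    (hag : ∀ r, r ≠ 12 → r ≠ 13 → r ≠ 14 → r ≠ 30 → r ≠ 31 → r ≠ 32 → S' r = S r) : Regs n S' :=
  h.of_agree fun r hr => hag r (by omega) (by omega) (by omega) (by omega) (by omega) (by omega)

section semantics

variable {n w : ℕ} {O : List ℕ → List ℕ} (A B : Matrix (Fin n) (Fin n) (WithTop ℤ))

/-- The input word list: the encoding of the distance-product instance `(A, B)`. [folklore] -/
def inp : List ℕ := encodeMatrixWithTop A ++ encodeMatrixWithTop B

/-- The code of entry `t = i n + j` of `A` (`0` past the matrix). [folklore] -/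
def codeA (t : ℕ) : ℕ := (encodeMatrixWithTop A).getD (t + 1) 0

/-- The code of entry `t = j n + k` of `B` (`0` past the matrix). [folklore] -/
def codeB (t : ℕ) : ℕ := (encodeMatrixWithTop B).getD (t + 1) 0

/-- The input has `2 n² + 2` words. [folklore] -/
theorem inp_length : (inp A B).length = 2 * (n * n) + 2 := by
  simp [inp, encodeMatrixWithTop_length, sq]; ring

/-- Cell `1` of the relocated memory holds `pD n`. [folklore] -/
theorem relocated_one' : relocated (inp A B) 1 = pD n := by
  rw [relocated_one, inp_length]; rfl

/-- Cell `pD n` of the relocated memory holds `n`. [folklore] -/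
theorem relocated_pD : relocated (inp A B) (pD n) = n := by
  have : pD n = (inp A B).length + 100 := by rw [inp_length]; rfl
  rw [this]
  unfold relocated
  rw [if_neg (by omega), if_neg (by omega), if_pos rfl]
  simp [inp, encodeMatrixWithTop]

/-- The relocated input: the code of entry `t` of `A` sits at `pA n + 1 + t`. [folklore] -/
theorem relocated_codeA {t : ℕ} (ht : t < n * n) : relocated (inp A B) (pA n + 1 + t) = codeA A t := by
  have hlen := inp_length A B
  have : pA n + 1 + t = (inp A B).length + 100 + (t + 2) := by rw [hlen, pA]; ring
  rw [this, relocated_base_add _ (by omega) (by rw [hlen]; omega), show t + 2 - 1 = t + 1 by omega,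
    codeA, inp, List.getD_append _ _ _ _ (by rw [encodeMatrixWithTop_length, sq]; omega)]

/-- The relocated input: the code of entry `t` of `B` sits at `pB n + 1 + t`. [folklore] -/
theorem relocated_codeB {t : ℕ} (ht : t < n * n) : relocated (inp A B) (pB n + 1 + t) = codeB B t := by
  have hlen := inp_length A B
  have hlA : (encodeMatrixWithTop A).length = n * n + 1 := by rw [encodeMatrixWithTop_length, sq]
  have : pB n + 1 + t = (inp A B).length + 100 + (n * n + 3 + t) := by rw [hlen, pB]; ring
  rw [this, relocated_base_add _ (by omega) (by rw [hlen]; omega), codeB, inp,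
    List.getD_append_right _ _ _ _ (by rw [hlA]; omega), hlA]
  congr 1
  omega

/-- Above the relocated input (from `pQ n` on) the memory is `0`. [folklore] -/
theorem relocated_high {a : ℕ} (ha : pQ n ≤ a) : relocated (inp A B) a = 0 :=
  relocated_of_lt _ (by rw [inp_length]; rw [pQ] at ha; omega)

/-- The codes of `A` are input words, hence below `2 ^ w` once the input width fits. [folklore] -/
theorem codeA_lt (hwid : inputWidth (inp A B) ≤ w) (t : ℕ) : codeA A t < 2 ^ w := by
  unfold codeA
  rw [List.getD_eq_getElem?_getD]
  cases h : (encodeMatrixWithTop A)[t + 1]? with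
  | none => simp
  | some v =>
    simp only [Option.getD_some]
    have hv : v ∈ inp A B := List.mem_append_left _ (List.mem_of_getElem? h)
    exact lt_of_lt_of_le (lt_two_pow_inputWidth_of_mem _ _ hv) (Nat.pow_le_pow_right Nat.two_pos hwid)

/-- The codes of `B` are input words, hence below `2 ^ w` once the input width fits. [folklore] -/
theorem codeB_lt (hwid : inputWidth (inp A B) ≤ w) (t : ℕ) : codeB B t < 2 ^ w := by
  unfold codeB
  rw [List.getD_eq_getElem?_getD]
  cases h : (encodeMatrixWithTop B)[t + 1]? with
  | none => simp
  | some v =>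
    simp only [Option.getD_some]
    have hv : v ∈ inp A B := List.mem_append_right _ (List.mem_of_getElem? h)
    exact lt_of_lt_of_le (lt_two_pow_inputWidth_of_mem _ _ hv) (Nat.pow_le_pow_right Nat.two_pos hwid)

/-! ### Setup -/

-- The symbolic execution below uses one uniform `simp only` read-normaliser per instruction;
-- not every lemma of the set fires at every instruction.
set_option linter.unusedSimpArgs false in
/-- **The setup block**: the layout registers, the parameters of the first row loop, and the query
header `3 n` at `pQ n`; the rest of the data is the relocated input. [folklore] -/
theorem setup_spec (hF : pTop n < 2 ^ w) (qs : List (List ℕ)) :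
    ∃ S H : ℕ → ℕ, Exec w O (block setupOps) ⟨merge (relocated (inp A B)) (relocated (inp A B)), qs⟩
        ⟨merge S H, qs⟩ 24 ∧
      Regs n S ∧ S 30 = n ∧ S 31 = pA n + 1 ∧ S 32 = pQ n + 1 + n ∧ S 33 = n ∧ S 34 = 3 * n ∧
      H (pQ n) = 3 * n ∧ ∀ a, a ≠ pQ n → H a = relocated (inp A B) a := by
  have hD : pD n = 2 * (n * n) + 102 := rfl
  have hA' : pA n = 2 * (n * n) + 103 := rfl
  have hQ : pQ n = 4 * (n * n) + 105 := rfl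
  have hRR : pR n = 13 * (n * n) + 106 := rfl
  have hT : pTop n = 22 * (n * n) + 108 := rfl
  have h1 : relocated (inp A B) 1 = pD n := relocated_one' A B
  have hDn : relocated (inp A B) (pD n) = n := relocated_pD A B
  have hnn : n ≤ n * n := Nat.le_mul_self n
  have key : ∀ R, execOps w (merge (relocated (inp A B)) (relocated (inp A B))) setupOps = R →
      ∃ S H : ℕ → ℕ, R = merge S H ∧
        Regs n S ∧ S 30 = n ∧ S 31 = pA n + 1 ∧ S 32 = pQ n + 1 + n ∧ S 33 = n ∧ S 34 = 3 * n ∧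
        H (pQ n) = 3 * n ∧ ∀ a, a ≠ pQ n → H a = relocated (inp A B) a := by
    intro R hR
    unfold setupOps at hR
    have htmp := execOps_cons_fwd hR; clear hR; obtain ⟨v1, hv1, hR⟩ := htmp
    simp -failIfUnchanged (disch := omega) only [Operand.write, Operand.read, merge_apply_of_lt,
      merge_apply_of_le, Function.update_self, Function.update_of_ne, update_merge_of_lt,
      update_merge_of_le, Nat.add_zero, BinOp.eval_mod, BinOp.eval_eq, BinOp.eval_band,
      BinOp.eval_shr, BinOp.eval_div, BinOp.eval_lt, BinOp.eval_add_of_lt, BinOp.eval_sub_of_le,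
      BinOp.eval_mul_of_lt, h1, hDn] at hv1 hR; subst hv1
    have htmp := execOps_cons_fwd hR; clear hR; obtain ⟨v2, hv2, hR⟩ := htmp
    simp -failIfUnchanged (disch := omega) only [Operand.write, Operand.read, merge_apply_of_lt,
      merge_apply_of_le, Function.update_self, Function.update_of_ne, update_merge_of_lt,
      update_merge_of_le, Nat.add_zero, BinOp.eval_mod, BinOp.eval_eq, BinOp.eval_band,
      BinOp.eval_shr, BinOp.eval_div, BinOp.eval_lt, BinOp.eval_add_of_lt, BinOp.eval_sub_of_le,
      BinOp.eval_mul_of_lt, h1, hDn] at hv2 hR; subst hv2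
    have htmp := execOps_cons_fwd hR; clear hR; obtain ⟨v3, hv3, hR⟩ := htmp
    simp -failIfUnchanged (disch := omega) only [Operand.write, Operand.read, merge_apply_of_lt,
      merge_apply_of_le, Function.update_self, Function.update_of_ne, update_merge_of_lt,
      update_merge_of_le, Nat.add_zero, BinOp.eval_mod, BinOp.eval_eq, BinOp.eval_band,
      BinOp.eval_shr, BinOp.eval_div, BinOp.eval_lt, BinOp.eval_add_of_lt, BinOp.eval_sub_of_le,
      BinOp.eval_mul_of_lt, h1, hDn] at hv3 hR; subst hv3
    have htmp := execOps_cons_fwd hR; clear hR; obtain ⟨v4, hv4, hR⟩ := htmp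
    simp -failIfUnchanged (disch := omega) only [Operand.write, Operand.read, merge_apply_of_lt,
      merge_apply_of_le, Function.update_self, Function.update_of_ne, update_merge_of_lt,
      update_merge_of_le, Nat.add_zero, BinOp.eval_mod, BinOp.eval_eq, BinOp.eval_band,
      BinOp.eval_shr, BinOp.eval_div, BinOp.eval_lt, BinOp.eval_add_of_lt, BinOp.eval_sub_of_le,
      BinOp.eval_mul_of_lt, h1, hDn] at hv4 hR; subst hv4
    have htmp := execOps_cons_fwd hR; clear hR; obtain ⟨v5, hv5, hR⟩ := htmp
    simp -failIfUnchanged (disch := omega) only [Operand.write, Operand.read, merge_apply_of_lt,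
      merge_apply_of_le, Function.update_self, Function.update_of_ne, update_merge_of_lt,
      update_merge_of_le, Nat.add_zero, BinOp.eval_mod, BinOp.eval_eq, BinOp.eval_band,
      BinOp.eval_shr, BinOp.eval_div, BinOp.eval_lt, BinOp.eval_add_of_lt, BinOp.eval_sub_of_le,
      BinOp.eval_mul_of_lt, h1, hDn] at hv5 hR; subst hv5
    have htmp := execOps_cons_fwd hR; clear hR; obtain ⟨v6, hv6, hR⟩ := htmp
    simp -failIfUnchanged (disch := omega) only [Operand.write, Operand.read, merge_apply_of_lt,
      merge_apply_of_le, Function.update_self, Function.update_of_ne, update_merge_of_lt,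
      update_merge_of_le, Nat.add_zero, BinOp.eval_mod, BinOp.eval_eq, BinOp.eval_band,
      BinOp.eval_shr, BinOp.eval_div, BinOp.eval_lt, BinOp.eval_add_of_lt, BinOp.eval_sub_of_le,
      BinOp.eval_mul_of_lt, h1, hDn] at hv6 hR; subst hv6
    have htmp := execOps_cons_fwd hR; clear hR; obtain ⟨v7, hv7, hR⟩ := htmp
    simp -failIfUnchanged (disch := omega) only [Operand.write, Operand.read, merge_apply_of_lt,
      merge_apply_of_le, Function.update_self, Function.update_of_ne, update_merge_of_lt,
      update_merge_of_le, Nat.add_zero, BinOp.eval_mod, BinOp.eval_eq, BinOp.eval_band,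
      BinOp.eval_shr, BinOp.eval_div, BinOp.eval_lt, BinOp.eval_add_of_lt, BinOp.eval_sub_of_le,
      BinOp.eval_mul_of_lt, h1, hDn] at hv7 hR; subst hv7
    have htmp := execOps_cons_fwd hR; clear hR; obtain ⟨v8, hv8, hR⟩ := htmp
    simp -failIfUnchanged (disch := omega) only [Operand.write, Operand.read, merge_apply_of_lt,
      merge_apply_of_le, Function.update_self, Function.update_of_ne, update_merge_of_lt,
      update_merge_of_le, Nat.add_zero, BinOp.eval_mod, BinOp.eval_eq, BinOp.eval_band,
      BinOp.eval_shr, BinOp.eval_div, BinOp.eval_lt, BinOp.eval_add_of_lt, BinOp.eval_sub_of_le,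
      BinOp.eval_mul_of_lt, h1, hDn] at hv8 hR; subst hv8
    have htmp := execOps_cons_fwd hR; clear hR; obtain ⟨v9, hv9, hR⟩ := htmp
    simp -failIfUnchanged (disch := omega) only [Operand.write, Operand.read, merge_apply_of_lt,
      merge_apply_of_le, Function.update_self, Function.update_of_ne, update_merge_of_lt,
      update_merge_of_le, Nat.add_zero, BinOp.eval_mod, BinOp.eval_eq, BinOp.eval_band,
      BinOp.eval_shr, BinOp.eval_div, BinOp.eval_lt, BinOp.eval_add_of_lt, BinOp.eval_sub_of_le,
      BinOp.eval_mul_of_lt, h1, hDn] at hv9 hR; subst hv9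
    have htmp := execOps_cons_fwd hR; clear hR; obtain ⟨v10, hv10, hR⟩ := htmp
    simp -failIfUnchanged (disch := omega) only [Operand.write, Operand.read, merge_apply_of_lt,
      merge_apply_of_le, Function.update_self, Function.update_of_ne, update_merge_of_lt,
      update_merge_of_le, Nat.add_zero, BinOp.eval_mod, BinOp.eval_eq, BinOp.eval_band,
      BinOp.eval_shr, BinOp.eval_div, BinOp.eval_lt, BinOp.eval_add_of_lt, BinOp.eval_sub_of_le,
      BinOp.eval_mul_of_lt, h1, hDn] at hv10 hR; subst hv10
    have htmp := execOps_cons_fwd hR; clear hR; obtain ⟨v11, hv11, hR⟩ := htmp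
    simp -failIfUnchanged (disch := omega) only [Operand.write, Operand.read, merge_apply_of_lt,
      merge_apply_of_le, Function.update_self, Function.update_of_ne, update_merge_of_lt,
      update_merge_of_le, Nat.add_zero, BinOp.eval_mod, BinOp.eval_eq, BinOp.eval_band,
      BinOp.eval_shr, BinOp.eval_div, BinOp.eval_lt, BinOp.eval_add_of_lt, BinOp.eval_sub_of_le,
      BinOp.eval_mul_of_lt, h1, hDn] at hv11 hR; subst hv11
    have htmp := execOps_cons_fwd hR; clear hR; obtain ⟨v12, hv12, hR⟩ := htmp
    simp -failIfUnchanged (disch := omega) only [Operand.write, Operand.read, merge_apply_of_lt,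
      merge_apply_of_le, Function.update_self, Function.update_of_ne, update_merge_of_lt,
      update_merge_of_le, Nat.add_zero, BinOp.eval_mod, BinOp.eval_eq, BinOp.eval_band,
      BinOp.eval_shr, BinOp.eval_div, BinOp.eval_lt, BinOp.eval_add_of_lt, BinOp.eval_sub_of_le,
      BinOp.eval_mul_of_lt, h1, hDn] at hv12 hR; subst hv12
    have htmp := execOps_cons_fwd hR; clear hR; obtain ⟨v13, hv13, hR⟩ := htmp
    simp -failIfUnchanged (disch := omega) only [Operand.write, Operand.read, merge_apply_of_lt,
      merge_apply_of_le, Function.update_self, Function.update_of_ne, update_merge_of_lt,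
      update_merge_of_le, Nat.add_zero, BinOp.eval_mod, BinOp.eval_eq, BinOp.eval_band,
      BinOp.eval_shr, BinOp.eval_div, BinOp.eval_lt, BinOp.eval_add_of_lt, BinOp.eval_sub_of_le,
      BinOp.eval_mul_of_lt, h1, hDn] at hv13 hR; subst hv13
    have htmp := execOps_cons_fwd hR; clear hR; obtain ⟨v14, hv14, hR⟩ := htmp
    simp -failIfUnchanged (disch := omega) only [Operand.write, Operand.read, merge_apply_of_lt,
      merge_apply_of_le, Function.update_self, Function.update_of_ne, update_merge_of_lt,
      update_merge_of_le, Nat.add_zero, BinOp.eval_mod, BinOp.eval_eq, BinOp.eval_band,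
      BinOp.eval_shr, BinOp.eval_div, BinOp.eval_lt, BinOp.eval_add_of_lt, BinOp.eval_sub_of_le,
      BinOp.eval_mul_of_lt, h1, hDn] at hv14 hR; subst hv14
    have htmp := execOps_cons_fwd hR; clear hR; obtain ⟨v15, hv15, hR⟩ := htmp
    simp -failIfUnchanged (disch := omega) only [Operand.write, Operand.read, merge_apply_of_lt,
      merge_apply_of_le, Function.update_self, Function.update_of_ne, update_merge_of_lt,
      update_merge_of_le, Nat.add_zero, BinOp.eval_mod, BinOp.eval_eq, BinOp.eval_band,
      BinOp.eval_shr, BinOp.eval_div, BinOp.eval_lt, BinOp.eval_add_of_lt, BinOp.eval_sub_of_le,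
      BinOp.eval_mul_of_lt, h1, hDn] at hv15 hR; subst hv15
    have htmp := execOps_cons_fwd hR; clear hR; obtain ⟨v16, hv16, hR⟩ := htmp
    simp -failIfUnchanged (disch := omega) only [Operand.write, Operand.read, merge_apply_of_lt,
      merge_apply_of_le, Function.update_self, Function.update_of_ne, update_merge_of_lt,
      update_merge_of_le, Nat.add_zero, BinOp.eval_mod, BinOp.eval_eq, BinOp.eval_band,
      BinOp.eval_shr, BinOp.eval_div, BinOp.eval_lt, BinOp.eval_add_of_lt, BinOp.eval_sub_of_le,
      BinOp.eval_mul_of_lt, h1, hDn] at hv16 hR; subst hv16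
    have htmp := execOps_cons_fwd hR; clear hR; obtain ⟨v17, hv17, hR⟩ := htmp
    simp -failIfUnchanged (disch := omega) only [Operand.write, Operand.read, merge_apply_of_lt,
      merge_apply_of_le, Function.update_self, Function.update_of_ne, update_merge_of_lt,
      update_merge_of_le, Nat.add_zero, BinOp.eval_mod, BinOp.eval_eq, BinOp.eval_band,
      BinOp.eval_shr, BinOp.eval_div, BinOp.eval_lt, BinOp.eval_add_of_lt, BinOp.eval_sub_of_le,
      BinOp.eval_mul_of_lt, h1, hDn] at hv17 hR; subst hv17
    have htmp := execOps_cons_fwd hR; clear hR; obtain ⟨v18, hv18, hR⟩ := htmp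
    simp -failIfUnchanged (disch := omega) only [Operand.write, Operand.read, merge_apply_of_lt,
      merge_apply_of_le, Function.update_self, Function.update_of_ne, update_merge_of_lt,
      update_merge_of_le, Nat.add_zero, BinOp.eval_mod, BinOp.eval_eq, BinOp.eval_band,
      BinOp.eval_shr, BinOp.eval_div, BinOp.eval_lt, BinOp.eval_add_of_lt, BinOp.eval_sub_of_le,
      BinOp.eval_mul_of_lt, h1, hDn] at hv18 hR; subst hv18
    have htmp := execOps_cons_fwd hR; clear hR; obtain ⟨v19, hv19, hR⟩ := htmp
    simp -failIfUnchanged (disch := omega) only [Operand.write, Operand.read, merge_apply_of_lt,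
      merge_apply_of_le, Function.update_self, Function.update_of_ne, update_merge_of_lt,
      update_merge_of_le, Nat.add_zero, BinOp.eval_mod, BinOp.eval_eq, BinOp.eval_band,
      BinOp.eval_shr, BinOp.eval_div, BinOp.eval_lt, BinOp.eval_add_of_lt, BinOp.eval_sub_of_le,
      BinOp.eval_mul_of_lt, h1, hDn] at hv19 hR; subst hv19
    have htmp := execOps_cons_fwd hR; clear hR; obtain ⟨v20, hv20, hR⟩ := htmp
    simp -failIfUnchanged (disch := omega) only [Operand.write, Operand.read, merge_apply_of_lt,
      merge_apply_of_le, Function.update_self, Function.update_of_ne, update_merge_of_lt,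
      update_merge_of_le, Nat.add_zero, BinOp.eval_mod, BinOp.eval_eq, BinOp.eval_band,
      BinOp.eval_shr, BinOp.eval_div, BinOp.eval_lt, BinOp.eval_add_of_lt, BinOp.eval_sub_of_le,
      BinOp.eval_mul_of_lt, h1, hDn] at hv20 hR; subst hv20
    have htmp := execOps_cons_fwd hR; clear hR; obtain ⟨v21, hv21, hR⟩ := htmp
    simp -failIfUnchanged (disch := omega) only [Operand.write, Operand.read, merge_apply_of_lt,
      merge_apply_of_le, Function.update_self, Function.update_of_ne, update_merge_of_lt,
      update_merge_of_le, Nat.add_zero, BinOp.eval_mod, BinOp.eval_eq, BinOp.eval_band,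
      BinOp.eval_shr, BinOp.eval_div, BinOp.eval_lt, BinOp.eval_add_of_lt, BinOp.eval_sub_of_le,
      BinOp.eval_mul_of_lt, h1, hDn] at hv21 hR; subst hv21
    have htmp := execOps_cons_fwd hR; clear hR; obtain ⟨v22, hv22, hR⟩ := htmp
    simp -failIfUnchanged (disch := omega) only [Operand.write, Operand.read, merge_apply_of_lt,
      merge_apply_of_le, Function.update_self, Function.update_of_ne, update_merge_of_lt,
      update_merge_of_le, Nat.add_zero, BinOp.eval_mod, BinOp.eval_eq, BinOp.eval_band,
      BinOp.eval_shr, BinOp.eval_div, BinOp.eval_lt, BinOp.eval_add_of_lt, BinOp.eval_sub_of_le,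
      BinOp.eval_mul_of_lt, h1, hDn] at hv22 hR; subst hv22
    have htmp := execOps_cons_fwd hR; clear hR; obtain ⟨v23, hv23, hR⟩ := htmp
    simp -failIfUnchanged (disch := omega) only [Operand.write, Operand.read, merge_apply_of_lt,
      merge_apply_of_le, Function.update_self, Function.update_of_ne, update_merge_of_lt,
      update_merge_of_le, Nat.add_zero, BinOp.eval_mod, BinOp.eval_eq, BinOp.eval_band,
      BinOp.eval_shr, BinOp.eval_div, BinOp.eval_lt, BinOp.eval_add_of_lt, BinOp.eval_sub_of_le,
      BinOp.eval_mul_of_lt, h1, hDn] at hv23 hR; subst hv23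
    have htmp := execOps_cons_fwd hR; clear hR; obtain ⟨v24, hv24, hR⟩ := htmp
    simp -failIfUnchanged (disch := omega) only [Operand.write, Operand.read, merge_apply_of_lt,
      merge_apply_of_le, Function.update_self, Function.update_of_ne, update_merge_of_lt,
      update_merge_of_le, Nat.add_zero, BinOp.eval_mod, BinOp.eval_eq, BinOp.eval_band,
      BinOp.eval_shr, BinOp.eval_div, BinOp.eval_lt, BinOp.eval_add_of_lt, BinOp.eval_sub_of_le,
      BinOp.eval_mul_of_lt, h1, hDn] at hv24 hR; subst hv24
    simp only [execOps_nil] at hR; subst hR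
    refine ⟨_, _, rfl, ⟨?_, ?_, ?_, ?_, ?_, ?_, ?_, ?_, ?_, ?_⟩, ?_, ?_, ?_, ?_, ?_, ?_, ?_⟩
    rotate_right 2
    · simp only [Function.update_apply]; split_ifs <;> first | rfl | omega
    · intro a ha
      simp only [Function.update_apply]; split_ifs <;> first | rfl | omega
    all_goals simp only [Function.update_self, Function.update_of_ne, ne_eq, Nat.reduceEqDiff,
      not_false_eq_true]
    all_goals omega
  obtain ⟨S, H, hR, h⟩ := key _ rfl
  exact ⟨S, H, Exec.block' setupOps qs hR, h⟩

/-! ### The parameter blocks of the second and third row loops, and the re-layout -/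

-- The symbolic execution below uses one uniform `simp only` read-normaliser per instruction;
-- not every lemma of the set fires at every instruction.
set_option linter.unusedSimpArgs false in
/-- **The parameters of the second row loop** (`preQB`). [folklore] -/
theorem preQB_spec {S H : ℕ → ℕ} (hRg : Regs n S) (hF : pTop n < 2 ^ w) (qs : List (List ℕ)) :
    ∃ S' : ℕ → ℕ, Exec w O (block preQB) ⟨merge S H, qs⟩ ⟨merge S' H, qs⟩ 6 ∧
      Regs n S' ∧ S' 30 = n ∧ S' 31 = pB n + 1 ∧ S' 32 = pQ n + 1 + 3 * (n * n) + 2 * n ∧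
      S' 33 = n ∧ S' 34 = 3 * n := by
  have hA' : pA n = 2 * (n * n) + 103 := rfl
  have hB' : pB n = 3 * (n * n) + 104 := rfl
  have hQ : pQ n = 4 * (n * n) + 105 := rfl
  have hT : pTop n = 22 * (n * n) + 108 := rfl
  have hnn : n ≤ n * n := Nat.le_mul_self n
  obtain ⟨h2, h3, h4, h5, h6, h7, h8, h9, h10, h11⟩ := hRg
  have key : ∀ R, execOps w (merge S H) preQB = R → ∃ S' : ℕ → ℕ, R = merge S' H ∧
      Regs n S' ∧ S' 30 = n ∧ S' 31 = pB n + 1 ∧ S' 32 = pQ n + 1 + 3 * (n * n) + 2 * n ∧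
      S' 33 = n ∧ S' 34 = 3 * n := by
    intro R hR
    unfold preQB at hR
    have htmp := execOps_cons_fwd hR; clear hR; obtain ⟨v1, hv1, hR⟩ := htmp
    simp -failIfUnchanged (disch := omega) only [Operand.write, Operand.read, merge_apply_of_lt,
      merge_apply_of_le, Function.update_self, Function.update_of_ne, update_merge_of_lt,
      update_merge_of_le, Nat.add_zero, BinOp.eval_mod, BinOp.eval_eq, BinOp.eval_band,
      BinOp.eval_shr, BinOp.eval_div, BinOp.eval_lt, BinOp.eval_add_of_lt, BinOp.eval_sub_of_le,
      BinOp.eval_mul_of_lt, h2, h3, h4, h5, h6, h7, h8, h9, h10, h11] at hv1 hR; subst hv1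
    have htmp := execOps_cons_fwd hR; clear hR; obtain ⟨v2, hv2, hR⟩ := htmp
    simp -failIfUnchanged (disch := omega) only [Operand.write, Operand.read, merge_apply_of_lt,
      merge_apply_of_le, Function.update_self, Function.update_of_ne, update_merge_of_lt,
      update_merge_of_le, Nat.add_zero, BinOp.eval_mod, BinOp.eval_eq, BinOp.eval_band,
      BinOp.eval_shr, BinOp.eval_div, BinOp.eval_lt, BinOp.eval_add_of_lt, BinOp.eval_sub_of_le,
      BinOp.eval_mul_of_lt, h2, h3, h4, h5, h6, h7, h8, h9, h10, h11] at hv2 hR; subst hv2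
    have htmp := execOps_cons_fwd hR; clear hR; obtain ⟨v3, hv3, hR⟩ := htmp
    simp -failIfUnchanged (disch := omega) only [Operand.write, Operand.read, merge_apply_of_lt,
      merge_apply_of_le, Function.update_self, Function.update_of_ne, update_merge_of_lt,
      update_merge_of_le, Nat.add_zero, BinOp.eval_mod, BinOp.eval_eq, BinOp.eval_band,
      BinOp.eval_shr, BinOp.eval_div, BinOp.eval_lt, BinOp.eval_add_of_lt, BinOp.eval_sub_of_le,
      BinOp.eval_mul_of_lt, h2, h3, h4, h5, h6, h7, h8, h9, h10, h11] at hv3 hR; subst hv3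
    have htmp := execOps_cons_fwd hR; clear hR; obtain ⟨v4, hv4, hR⟩ := htmp
    simp -failIfUnchanged (disch := omega) only [Operand.write, Operand.read, merge_apply_of_lt,
      merge_apply_of_le, Function.update_self, Function.update_of_ne, update_merge_of_lt,
      update_merge_of_le, Nat.add_zero, BinOp.eval_mod, BinOp.eval_eq, BinOp.eval_band,
      BinOp.eval_shr, BinOp.eval_div, BinOp.eval_lt, BinOp.eval_add_of_lt, BinOp.eval_sub_of_le,
      BinOp.eval_mul_of_lt, h2, h3, h4, h5, h6, h7, h8, h9, h10, h11] at hv4 hR; subst hv4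
    have htmp := execOps_cons_fwd hR; clear hR; obtain ⟨v5, hv5, hR⟩ := htmp
    simp -failIfUnchanged (disch := omega) only [Operand.write, Operand.read, merge_apply_of_lt,
      merge_apply_of_le, Function.update_self, Function.update_of_ne, update_merge_of_lt,
      update_merge_of_le, Nat.add_zero, BinOp.eval_mod, BinOp.eval_eq, BinOp.eval_band,
      BinOp.eval_shr, BinOp.eval_div, BinOp.eval_lt, BinOp.eval_add_of_lt, BinOp.eval_sub_of_le,
      BinOp.eval_mul_of_lt, h2, h3, h4, h5, h6, h7, h8, h9, h10, h11] at hv5 hR; subst hv5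
    have htmp := execOps_cons_fwd hR; clear hR; obtain ⟨v6, hv6, hR⟩ := htmp
    simp -failIfUnchanged (disch := omega) only [Operand.write, Operand.read, merge_apply_of_lt,
      merge_apply_of_le, Function.update_self, Function.update_of_ne, update_merge_of_lt,
      update_merge_of_le, Nat.add_zero, BinOp.eval_mod, BinOp.eval_eq, BinOp.eval_band,
      BinOp.eval_shr, BinOp.eval_div, BinOp.eval_lt, BinOp.eval_add_of_lt, BinOp.eval_sub_of_le,
      BinOp.eval_mul_of_lt, h2, h3, h4, h5, h6, h7, h8, h9, h10, h11] at hv6 hR; subst hv6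
    simp only [execOps_nil] at hR; subst hR
    refine ⟨_, rfl, ⟨?_, ?_, ?_, ?_, ?_, ?_, ?_, ?_, ?_, ?_⟩, ?_, ?_, ?_, ?_, ?_⟩
    all_goals simp only [Function.update_self, Function.update_of_ne, ne_eq, Nat.reduceEqDiff,
      not_false_eq_true]
    all_goals omega
  obtain ⟨S', hR, h⟩ := key _ rfl
  exact ⟨S', Exec.block' preQB qs hR, h⟩

-- The symbolic execution below uses one uniform `simp only` read-normaliser per instruction;
-- not every lemma of the set fires at every instruction.
set_option linter.unusedSimpArgs false in
/-- **The parameters of the third row loop** (`preRD`). [folklore] -/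
theorem preRD_spec {S H : ℕ → ℕ} (hRg : Regs n S) (hF : pTop n < 2 ^ w) (qs : List (List ℕ)) :
    ∃ S' : ℕ → ℕ, Exec w O (block preRD) ⟨merge S H, qs⟩ ⟨merge S' H, qs⟩ 5 ∧
      Regs n S' ∧ S' 30 = n ∧ S' 31 = pR n + 2 + 2 * n ∧ S' 32 = pA n + 1 ∧
      S' 33 = 3 * n ∧ S' 34 = n := by
  have hA' : pA n = 2 * (n * n) + 103 := rfl
  have hQ : pQ n = 4 * (n * n) + 105 := rfl
  have hRR : pR n = 13 * (n * n) + 106 := rfl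
  have hT : pTop n = 22 * (n * n) + 108 := rfl
  have hnn : n ≤ n * n := Nat.le_mul_self n
  obtain ⟨h2, h3, h4, h5, h6, h7, h8, h9, h10, h11⟩ := hRg
  have key : ∀ R, execOps w (merge S H) preRD = R → ∃ S' : ℕ → ℕ, R = merge S' H ∧
      Regs n S' ∧ S' 30 = n ∧ S' 31 = pR n + 2 + 2 * n ∧ S' 32 = pA n + 1 ∧
      S' 33 = 3 * n ∧ S' 34 = n := by
    intro R hR
    unfold preRD at hR
    have htmp := execOps_cons_fwd hR; clear hR; obtain ⟨v1, hv1, hR⟩ := htmp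
    simp -failIfUnchanged (disch := omega) only [Operand.write, Operand.read, merge_apply_of_lt,
      merge_apply_of_le, Function.update_self, Function.update_of_ne, update_merge_of_lt,
      update_merge_of_le, Nat.add_zero, BinOp.eval_mod, BinOp.eval_eq, BinOp.eval_band,
      BinOp.eval_shr, BinOp.eval_div, BinOp.eval_lt, BinOp.eval_add_of_lt, BinOp.eval_sub_of_le,
      BinOp.eval_mul_of_lt, h2, h3, h4, h5, h6, h7, h8, h9, h10, h11] at hv1 hR; subst hv1
    have htmp := execOps_cons_fwd hR; clear hR; obtain ⟨v2, hv2, hR⟩ := htmp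
    simp -failIfUnchanged (disch := omega) only [Operand.write, Operand.read, merge_apply_of_lt,
      merge_apply_of_le, Function.update_self, Function.update_of_ne, update_merge_of_lt,
      update_merge_of_le, Nat.add_zero, BinOp.eval_mod, BinOp.eval_eq, BinOp.eval_band,
      BinOp.eval_shr, BinOp.eval_div, BinOp.eval_lt, BinOp.eval_add_of_lt, BinOp.eval_sub_of_le,
      BinOp.eval_mul_of_lt, h2, h3, h4, h5, h6, h7, h8, h9, h10, h11] at hv2 hR; subst hv2
    have htmp := execOps_cons_fwd hR; clear hR; obtain ⟨v3, hv3, hR⟩ := htmp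
    simp -failIfUnchanged (disch := omega) only [Operand.write, Operand.read, merge_apply_of_lt,
      merge_apply_of_le, Function.update_self, Function.update_of_ne, update_merge_of_lt,
      update_merge_of_le, Nat.add_zero, BinOp.eval_mod, BinOp.eval_eq, BinOp.eval_band,
      BinOp.eval_shr, BinOp.eval_div, BinOp.eval_lt, BinOp.eval_add_of_lt, BinOp.eval_sub_of_le,
      BinOp.eval_mul_of_lt, h2, h3, h4, h5, h6, h7, h8, h9, h10, h11] at hv3 hR; subst hv3
    have htmp := execOps_cons_fwd hR; clear hR; obtain ⟨v4, hv4, hR⟩ := htmp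
    simp -failIfUnchanged (disch := omega) only [Operand.write, Operand.read, merge_apply_of_lt,
      merge_apply_of_le, Function.update_self, Function.update_of_ne, update_merge_of_lt,
      update_merge_of_le, Nat.add_zero, BinOp.eval_mod, BinOp.eval_eq, BinOp.eval_band,
      BinOp.eval_shr, BinOp.eval_div, BinOp.eval_lt, BinOp.eval_add_of_lt, BinOp.eval_sub_of_le,
      BinOp.eval_mul_of_lt, h2, h3, h4, h5, h6, h7, h8, h9, h10, h11] at hv4 hR; subst hv4
    have htmp := execOps_cons_fwd hR; clear hR; obtain ⟨v5, hv5, hR⟩ := htmp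
    simp -failIfUnchanged (disch := omega) only [Operand.write, Operand.read, merge_apply_of_lt,
      merge_apply_of_le, Function.update_self, Function.update_of_ne, update_merge_of_lt,
      update_merge_of_le, Nat.add_zero, BinOp.eval_mod, BinOp.eval_eq, BinOp.eval_band,
      BinOp.eval_shr, BinOp.eval_div, BinOp.eval_lt, BinOp.eval_add_of_lt, BinOp.eval_sub_of_le,
      BinOp.eval_mul_of_lt, h2, h3, h4, h5, h6, h7, h8, h9, h10, h11] at hv5 hR; subst hv5
    simp only [execOps_nil] at hR; subst hR
    refine ⟨_, rfl, ⟨?_, ?_, ?_, ?_, ?_, ?_, ?_, ?_, ?_, ?_⟩, ?_, ?_, ?_, ?_, ?_⟩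
    all_goals simp only [Function.update_self, Function.update_of_ne, ne_eq, Nat.reduceEqDiff,
      not_false_eq_true]
    all_goals omega
  obtain ⟨S', hR, h⟩ := key _ rfl
  exact ⟨S', Exec.block' preRD qs hR, h⟩

-- The symbolic execution below uses one uniform `simp only` read-normaliser per instruction;
-- not every lemma of the set fires at every instruction.
set_option linter.unusedSimpArgs false in
/-- **The re-layout block**: afterwards the registers `2, …, 9` are those of the driver's layout
`APSPPower.Lay n (S 9)` (with the result block `pA n = dQA n` as the accumulator block). [folklore] -/
theorem relay_spec {S H : ℕ → ℕ} (hRg : Regs n S) (hF : pTop n < 2 ^ w) (qs : List (List ℕ)) :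
    ∃ S' : ℕ → ℕ, Exec w O (block relayOps) ⟨merge S H, qs⟩ ⟨merge S' H, qs⟩ 8 ∧
      APSPPower.Lay n (S 9) S' := by
  have hA' : pA n = 2 * (n * n) + 103 := rfl
  have hQ : pQ n = 4 * (n * n) + 105 := rfl
  have hRR : pR n = 13 * (n * n) + 106 := rfl
  have hT : pTop n = 22 * (n * n) + 108 := rfl
  have hdD := APSPPower.dD_eq n; have hdQA := APSPPower.dQA_eq n; have hdQP := APSPPower.dQP_eq n
  have hdQP2 := APSPPower.dQP2_eq n; have hdOUT := APSPPower.dOUT_eq n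
  have hnn : n ≤ n * n := Nat.le_mul_self n
  obtain ⟨h2, h3, h4, h5, h6, h7, h8, h9, h10, h11⟩ := hRg
  have key : ∀ R, execOps w (merge S H) relayOps = R → ∃ S' : ℕ → ℕ, R = merge S' H ∧
      APSPPower.Lay n (S 9) S' := by
    intro R hR
    unfold relayOps at hR
    have htmp := execOps_cons_fwd hR; clear hR; obtain ⟨v1, hv1, hR⟩ := htmp
    simp -failIfUnchanged (disch := omega) only [Operand.write, Operand.read, merge_apply_of_lt,
      merge_apply_of_le, Function.update_self, Function.update_of_ne, update_merge_of_lt,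
      update_merge_of_le, Nat.add_zero, BinOp.eval_mod, BinOp.eval_eq, BinOp.eval_band,
      BinOp.eval_shr, BinOp.eval_div, BinOp.eval_lt, BinOp.eval_add_of_lt, BinOp.eval_sub_of_le,
      BinOp.eval_mul_of_lt, h2, h3, h4, h5, h6, h7, h8, h9, h10, h11] at hv1 hR; subst hv1
    have htmp := execOps_cons_fwd hR; clear hR; obtain ⟨v2, hv2, hR⟩ := htmp
    simp -failIfUnchanged (disch := omega) only [Operand.write, Operand.read, merge_apply_of_lt,
      merge_apply_of_le, Function.update_self, Function.update_of_ne, update_merge_of_lt,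
      update_merge_of_le, Nat.add_zero, BinOp.eval_mod, BinOp.eval_eq, BinOp.eval_band,
      BinOp.eval_shr, BinOp.eval_div, BinOp.eval_lt, BinOp.eval_add_of_lt, BinOp.eval_sub_of_le,
      BinOp.eval_mul_of_lt, h2, h3, h4, h5, h6, h7, h8, h9, h10, h11] at hv2 hR; subst hv2
    have htmp := execOps_cons_fwd hR; clear hR; obtain ⟨v3, hv3, hR⟩ := htmp
    simp -failIfUnchanged (disch := omega) only [Operand.write, Operand.read, merge_apply_of_lt,
      merge_apply_of_le, Function.update_self, Function.update_of_ne, update_merge_of_lt,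
      update_merge_of_le, Nat.add_zero, BinOp.eval_mod, BinOp.eval_eq, BinOp.eval_band,
      BinOp.eval_shr, BinOp.eval_div, BinOp.eval_lt, BinOp.eval_add_of_lt, BinOp.eval_sub_of_le,
      BinOp.eval_mul_of_lt, h2, h3, h4, h5, h6, h7, h8, h9, h10, h11] at hv3 hR; subst hv3
    have htmp := execOps_cons_fwd hR; clear hR; obtain ⟨v4, hv4, hR⟩ := htmp
    simp -failIfUnchanged (disch := omega) only [Operand.write, Operand.read, merge_apply_of_lt,
      merge_apply_of_le, Function.update_self, Function.update_of_ne, update_merge_of_lt,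
      update_merge_of_le, Nat.add_zero, BinOp.eval_mod, BinOp.eval_eq, BinOp.eval_band,
      BinOp.eval_shr, BinOp.eval_div, BinOp.eval_lt, BinOp.eval_add_of_lt, BinOp.eval_sub_of_le,
      BinOp.eval_mul_of_lt, h2, h3, h4, h5, h6, h7, h8, h9, h10, h11] at hv4 hR; subst hv4
    have htmp := execOps_cons_fwd hR; clear hR; obtain ⟨v5, hv5, hR⟩ := htmp
    simp -failIfUnchanged (disch := omega) only [Operand.write, Operand.read, merge_apply_of_lt,
      merge_apply_of_le, Function.update_self, Function.update_of_ne, update_merge_of_lt,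
      update_merge_of_le, Nat.add_zero, BinOp.eval_mod, BinOp.eval_eq, BinOp.eval_band,
      BinOp.eval_shr, BinOp.eval_div, BinOp.eval_lt, BinOp.eval_add_of_lt, BinOp.eval_sub_of_le,
      BinOp.eval_mul_of_lt, h2, h3, h4, h5, h6, h7, h8, h9, h10, h11] at hv5 hR; subst hv5
    have htmp := execOps_cons_fwd hR; clear hR; obtain ⟨v6, hv6, hR⟩ := htmp
    simp -failIfUnchanged (disch := omega) only [Operand.write, Operand.read, merge_apply_of_lt,
      merge_apply_of_le, Function.update_self, Function.update_of_ne, update_merge_of_lt,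
      update_merge_of_le, Nat.add_zero, BinOp.eval_mod, BinOp.eval_eq, BinOp.eval_band,
      BinOp.eval_shr, BinOp.eval_div, BinOp.eval_lt, BinOp.eval_add_of_lt, BinOp.eval_sub_of_le,
      BinOp.eval_mul_of_lt, h2, h3, h4, h5, h6, h7, h8, h9, h10, h11] at hv6 hR; subst hv6
    have htmp := execOps_cons_fwd hR; clear hR; obtain ⟨v7, hv7, hR⟩ := htmp
    simp -failIfUnchanged (disch := omega) only [Operand.write, Operand.read, merge_apply_of_lt,
      merge_apply_of_le, Function.update_self, Function.update_of_ne, update_merge_of_lt,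
      update_merge_of_le, Nat.add_zero, BinOp.eval_mod, BinOp.eval_eq, BinOp.eval_band,
      BinOp.eval_shr, BinOp.eval_div, BinOp.eval_lt, BinOp.eval_add_of_lt, BinOp.eval_sub_of_le,
      BinOp.eval_mul_of_lt, h2, h3, h4, h5, h6, h7, h8, h9, h10, h11] at hv7 hR; subst hv7
    have htmp := execOps_cons_fwd hR; clear hR; obtain ⟨v8, hv8, hR⟩ := htmp
    simp -failIfUnchanged (disch := omega) only [Operand.write, Operand.read, merge_apply_of_lt,
      merge_apply_of_le, Function.update_self, Function.update_of_ne, update_merge_of_lt,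
      update_merge_of_le, Nat.add_zero, BinOp.eval_mod, BinOp.eval_eq, BinOp.eval_band,
      BinOp.eval_shr, BinOp.eval_div, BinOp.eval_lt, BinOp.eval_add_of_lt, BinOp.eval_sub_of_le,
      BinOp.eval_mul_of_lt, h2, h3, h4, h5, h6, h7, h8, h9, h10, h11] at hv8 hR; subst hv8
    simp only [execOps_nil] at hR; subst hR
    refine ⟨_, rfl, ⟨?_, ?_, ?_, ?_, ?_, ?_, ?_, ?_⟩⟩
    all_goals simp only [Function.update_self, Function.update_of_ne, ne_eq, Nat.reduceEqDiff,
      not_false_eq_true]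
    all_goals omega
  obtain ⟨S', hR, h⟩ := key _ rfl
  exact ⟨S', Exec.block' relayOps qs hR, h⟩

end semantics

end Literature.Computability.FineGrained.MinPlusToAPSP
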